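import Literature.Analysis.FunctionSpaces.GaussianSchwartz
import Literature.Analysis.UnboundedOperators.HeatKernelBoundedData
import HarnessLib

/-!
# Barrier: no uniform sup-norm gain from the heat semigroup, and symbol bounds are not
# sup-norm bounds (frequency cut-offs do not contract `L^∞`)

Barrier catalogue entry for `NavierStokesRegularity` (D-0021), METHOD LEVEL, everything PROVED
(zero fact debt). It records, as kernel theorems over the tree's caloric extension
`Literature.Analysis.UnboundedOperators.heatExtension f t = heatKernel t ⋆ f = e^{tΔ} f`, the
three elementary facts that defeat «sup-norm one-step contraction» schemes for heat / Stokes /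
Navier–Stokes mild formulations built on Fourier-multiplier cut-offs:

* `heatExtension_exp_neg_mul_norm_sq`: the heat flow of a Gaussian is explicit,
  `e^{tΔ} e^{-a‖·‖²} = (1 + 4at)^{-n/2} e^{-(a/(1+4at))‖·‖²}` (`n = dim E`);
* **(A) no uniform gain** (`tendsto_heatExtension_gaussian_nhdsGT_zero`,
  `exists_schwartz_heatExtension_gt`, `not_exists_uniform_supNorm_contraction`): for every
  `t > 0`, `sup {‖e^{tΔ}f‖_∞ : f ∈ 𝓢, ‖f‖_∞ ≤ 1} = 1` — wide Gaussians are moved arbitrarily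
  little; so `‖e^{tΔ} f‖_∞ ≤ θ‖f‖_∞` with ONE `θ < 1` for all Schwartz `f` is false, and an
  operator whose symbol equals `1` at the zero frequency (a low-pass part, here `e^{tΔ}` itself)
  is never `ε`-small on `L^∞`, whatever `ε < 1`;
* **(B) a symbol with values in `[0, 1)` can almost DOUBLE the sup-norm**
  (`tendsto_bandedHeat_probe_atTop`, `exists_bandedHeat_supNorm_amplification`,
  `not_symbolBound_imp_supNormBound`): the band operator `e^{aΔ} - e^{bΔ}` (`0 < a < b`), whose
  Fourier symbol `heatSymbol a - heatSymbol b` takes values in `[0, 1)` and VANISHES at `ξ = 0`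
  (`heatSymbol_sub_mem_Ico`, `heatSymbol_sub_apply_zero`) — the shape «heat semigroup ∘ smooth
  high-pass cut-off» — satisfies `sup_f (e^{aΔ} - e^{bΔ}) f (0) / ‖f‖_∞ → 2` along two-scale
  Gaussian probes `2e^{-‖x‖²/(4R)} - e^{-‖x‖²/(4R³)}`, `a = 1`, `b = R²`, `R → ∞`;
* (C) the bookkeeping consequence (prose only, elementary): without a uniform gain, a one-step
  bound `x_{k+1} ≤ (1 + c) x_k` whose increment `c ≥ c₀ > 0` is NOT `o(step)` admits the
  extremal sequence `(1 + c)^k x₀` and yields no bound uniform in `k` — dropping such increments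
  as «small» before iterating is not a valid inference; increments proportional to the step,
  `c = Cδt`, integrate to the honest Gronwall factor `(1 + Ct/N)^N ≤ e^{Ct}`, finite on finite
  horizons and only as good as the a priori control of `C`.

## Why this is a barrier (the classical facts behind (A)–(B))

The `L¹ → L¹` operator norm of a translation-invariant operator is the TOTAL VARIATION of its
convolution kernel (a finite Borel measure), Grafakos, *Classical Fourier Analysis*, Thm. 2.5.8,
and such operators act on every `L^p`, `1 ≤ p ≤ ∞`, with the same bound (remark after
Thm. 2.5.8: `M^{1,1} ⊂ M^{∞,∞}`; for an `L¹` kernel `k` the `L^∞ → L^∞` norm is `‖k‖_{L¹}`,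
attained along `f ≈ sgn k(-·)`), whereas the `L² → L²` norm is the sup of the symbol,
Thm. 2.5.10 (Plancherel; in the tree: `norm_fourierMultiplier_le` of the `Tao2016` toolkit). A pointwise symbol
bound `0 ≤ m < 1` therefore contracts `L²` but says nothing about `L^∞`: a kernel with zero mean
(`m(0) = 0`) and `sup m` close to `1` is a difference of two unit-mass bumps at separated scales
and has total variation close to `2` — this is (B); and a positive unit-mass kernel (symbol `1`
at the origin) has norm exactly `1`, never `< 1` and never `≤ ε` — this is (A). The sup-norm
bounds that DO hold come from positivity, not from symbol size: `‖e^{tΔ}f‖_∞ ≤ ‖f‖_∞`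
(tree: `Literature.Analysis.UnboundedOperators.norm_heatExtension_le`, Evans §2.3.1), the
parabolic maximum principle for scalar advection–diffusion, e.g. the 2D vorticity
(Majda–Bertozzi §3.3).

## Rendering

Physical space is any finite-dimensional real inner product space `E` (`ℝ³` included); (B) needs
`0 < dim E`. Operators are rendered on the kernel side (`heatExtension`, real-valued data, values
at the point `0`), probes are honest Schwartz functions
(`Literature.Analysis.FunctionSpaces.realGaussianSchwartz`), so the statements instantiate
claims typed over `𝓢(E, ℝ)` verbatim. The Fourier side enters only through the symbol lemmas
for `heatSymbol` (the multiplier of `e^{tΔ}`, tree `fourierIntegral_heatKernel_holds`).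

## References

* L. Grafakos, *Classical Fourier Analysis*, 3rd ed., GTM 249 (2014), §2.5.4, Thm. 2.5.8 (and
  the remark following its proof), Thm. 2.5.10. [`Grafakos2014`]
* L. C. Evans, *Partial Differential Equations*, 2nd ed. (2010), §2.3.1. [`Evans2010`]
* D. Applebaum, *Semigroups of Linear Operators*, CUP (2019), §3.1.1, eq. (3.1.3) p. 48 (the
  Gaussian convolution semigroup). [`Applebaum2019`]
* A. J. Majda, A. L. Bertozzi, *Vorticity and Incompressible Flow*, CUP (2002), §3.3 (the 2D
  vorticity maximum principle before Cor. 3.3). [`MajdaBertozziCUP2002`]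
* E. M. Stein, *Singular Integrals and Differentiability Properties of Functions* (1970),
  Ch. III §2 (Gauss–Weierstrass kernel). [`SteinSingularIntegrals1970`]

WHAT THIS IS NOT: not a claim about NS regularity or blow-up; not a claim about any author beyond
the typed locator.
-/

noncomputable section

open MeasureTheory Filter Topology Set
open scoped Real SchwartzMap

namespace Literature.Barriers.NavierStokesRegularity

open Literature.Analysis.UnboundedOperators
open Literature.Analysis.FunctionSpaces (realGaussianSchwartz realGaussianSchwartz_apply)

/-! ## Pointwise facts: Gaussian probes and the Fourier symbols involved -/

section Pointwise

variable {E : Type*} [NormedAddCommGroup E]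

/-- The Gaussian probe takes values in `(0, 1]`. [folklore] -/
private theorem exp_neg_mul_norm_sq_mem_Ioc {a : ℝ} (ha : 0 ≤ a) (x : E) :
    Real.exp (-a * ‖x‖ ^ 2) ∈ Ioc (0 : ℝ) 1 := by
  refine ⟨Real.exp_pos _, ?_⟩
  rw [Real.exp_le_one_iff]
  nlinarith [sq_nonneg ‖x‖]

/-- Wider Gaussians are larger: `e^{-a‖x‖²} ≤ e^{-b‖x‖²}` when `b ≤ a`. [folklore] -/
private theorem exp_neg_mul_norm_sq_mono {a b : ℝ} (hba : b ≤ a) (x : E) :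
    Real.exp (-a * ‖x‖ ^ 2) ≤ Real.exp (-b * ‖x‖ ^ 2) := by
  apply Real.exp_le_exp.2
  nlinarith [sq_nonneg ‖x‖]

/-- The two-scale probe `2e^{-‖x‖²/(4R)} - e^{-‖x‖²/(4R³)}` has sup-norm at most `1` for `R ≥ 1`
(`g₁ ≤ g₂ ≤ 1` pointwise for the narrower `g₁`, so `-1 ≤ -g₂ ≤ 2g₁ - g₂ ≤ g₁ ≤ 1`). [folklore] -/
private theorem abs_twoScaleProbe_le_one {R : ℝ} (hR : 1 ≤ R) (x : E) :
    |2 * Real.exp (-(1 / (4 * R)) * ‖x‖ ^ 2) - Real.exp (-(1 / (4 * R ^ 3)) * ‖x‖ ^ 2)| ≤ 1 := by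
  have hR0 : 0 < R := by linarith
  have h1 := exp_neg_mul_norm_sq_mem_Ioc (E := E) (a := 1 / (4 * R)) (by positivity) x
  have h2 := exp_neg_mul_norm_sq_mem_Ioc (E := E) (a := 1 / (4 * R ^ 3)) (by positivity) x
  have h12 : Real.exp (-(1 / (4 * R)) * ‖x‖ ^ 2) ≤ Real.exp (-(1 / (4 * R ^ 3)) * ‖x‖ ^ 2) := by
    apply exp_neg_mul_norm_sq_mono
    have hR3 : R ≤ R ^ 3 := by
      have h : R ^ 3 - R = R * (R - 1) * (R + 1) := by ring
      have h' : 0 ≤ R * (R - 1) * (R + 1) :=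
        mul_nonneg (mul_nonneg hR0.le (by linarith)) (by linarith)
      linarith
    exact one_div_le_one_div_of_le (by positivity) (by linarith)
  rw [abs_le]
  constructor <;> linarith [h1.1, h1.2, h2.1, h2.2]

/-- The symbol of the band operator `e^{aΔ} - e^{bΔ}`, `0 ≤ a ≤ b`, takes values in `[0, 1)`:
`0 ≤ e^{-(2π)²a‖ξ‖²} - e^{-(2π)²b‖ξ‖²} < 1` (the Gauss–Weierstrass symbols `e^{-4π²t|ξ|²}` of
Stein, *Singular Integrals*, Ch. III §2; so the operator is an `L²`-contraction by Plancherel,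
Grafakos Thm. 2.5.10). [cite: SteinSingularIntegrals1970, Ch. III §2] -/
theorem heatSymbol_sub_mem_Ico {a b : ℝ} (ha : 0 ≤ a) (hab : a ≤ b) (ξ : E) :
    heatSymbol a ξ - heatSymbol b ξ ∈ Ico (0 : ℝ) 1 := by
  refine ⟨?_, ?_⟩
  · rw [sub_nonneg, heatSymbol, heatSymbol]
    apply Real.exp_le_exp.2
    have : 0 ≤ (2 * π) ^ 2 * ‖ξ‖ ^ 2 := by positivity
    nlinarith
  · have h1 : heatSymbol a ξ ≤ 1 := heatSymbol_le_one ha ξ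
    have h2 : 0 < heatSymbol b ξ := heatSymbol_pos b ξ
    linarith

/-- The band symbol vanishes at the zero frequency (the kernel of `e^{aΔ} - e^{bΔ}` has zero
mean), exactly like a «heat semigroup ∘ high-pass cut-off» symbol; Gauss–Weierstrass symbols as
in Stein, *Singular Integrals*, Ch. III §2. [cite: SteinSingularIntegrals1970, Ch. III §2] -/
theorem heatSymbol_sub_apply_zero (a b : ℝ) : heatSymbol a (0 : E) - heatSymbol b (0 : E) = 0 := by
  simp [heatSymbol]

/-- The symbol of `e^{tΔ}` equals `1` at the zero frequency (a low-pass symbol: the kernel has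
unit mass), Stein, *Singular Integrals*, Ch. III §2. [cite: SteinSingularIntegrals1970, Ch. III §2] -/
theorem heatSymbol_apply_zero (t : ℝ) : heatSymbol t (0 : E) = 1 := by
  simp [heatSymbol]

end Pointwise

section Heat

variable {E : Type*} [NormedAddCommGroup E] [InnerProductSpace ℝ E] [FiniteDimensional ℝ E]
  [MeasurableSpace E] [BorelSpace E]

/-! ## Gaussians under the heat flow -/

/-- **Heat flow of a Gaussian.** For `0 < a`, `0 < t` and every `x`:
`e^{tΔ} (e^{-a‖·‖²}) (x) = (1/(1 + 4at))^{n/2} e^{-(a/(1+4at)) ‖x‖²}`, `n = dim E` — the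
Gaussian convolution semigroup law `γ_s ⋆ γ_t = γ_{s+t}` (Applebaum, *Semigroups of Linear
Operators*, §3.1.1 eq. (3.1.3); tree: `heatKernel_convolution_heatKernel_holds`) written for the
un-normalised Gaussian `e^{-a‖·‖²} = (π/a)^{n/2} heatKernel (1/(4a))` (complete the square; the
tree's `integral_rexp_neg_mul_sq_norm_mul_rexp_neg_mul_sq_norm_sub`).
[cite: Applebaum2019, §3.1.1 eq. (3.1.3) p. 48] -/
theorem heatExtension_exp_neg_mul_norm_sq {a t : ℝ} (ha : 0 < a) (ht : 0 < t) (x : E) :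
    heatExtension (fun y : E => Real.exp (-a * ‖y‖ ^ 2)) t x =
      (1 / (1 + 4 * a * t)) ^ ((Module.finrank ℝ E : ℝ) / 2) *
        Real.exp (-(a / (1 + 4 * a * t)) * ‖x‖ ^ 2) := by
  rw [heatExtension_apply]
  simp only [smul_eq_mul, heatKernel_eq]
  have hassoc : (fun y : E => (4 * π * t) ^ (-(Module.finrank ℝ E : ℝ) / 2) *
      Real.exp (-(1 / (4 * t)) * ‖y‖ ^ 2) * Real.exp (-a * ‖x - y‖ ^ 2)) =
      fun y : E => (4 * π * t) ^ (-(Module.finrank ℝ E : ℝ) / 2) *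
        (Real.exp (-(1 / (4 * t)) * ‖y‖ ^ 2) * Real.exp (-a * ‖x - y‖ ^ 2)) := by
    funext y
    ring
  rw [hassoc, integral_const_mul,
    integral_rexp_neg_mul_sq_norm_mul_rexp_neg_mul_sq_norm_sub (by positivity) ha]
  have ht0 : t ≠ 0 := ht.ne'
  have hπ0 : (π : ℝ) ≠ 0 := Real.pi_pos.ne'
  have ha0 : a ≠ 0 := ha.ne'
  have hden : 1 + 4 * a * t ≠ 0 := by positivity
  have hden' : 1 / (4 * t) + a ≠ 0 := by positivity
  have h4t : (0 : ℝ) ≤ 4 * π * t := by positivity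
  have hπ : (0 : ℝ) ≤ π / (1 / (4 * t) + a) := by positivity
  have hr : -(Module.finrank ℝ E : ℝ) / 2 = -((Module.finrank ℝ E : ℝ) / 2) := by ring
  have hexp : 1 / (4 * t) * a / (1 / (4 * t) + a) = a / (1 + 4 * a * t) := by
    field_simp
  have hbase : (4 * π * t)⁻¹ * (π / (1 / (4 * t) + a)) = 1 / (1 + 4 * a * t) := by
    field_simp
  rw [← mul_assoc, hr, Real.rpow_neg h4t, ← Real.inv_rpow h4t,
    ← Real.mul_rpow (inv_nonneg.2 h4t) hπ, hexp, hbase]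

/-- Value at the origin of the heat flow of a Gaussian: `e^{tΔ}(e^{-a‖·‖²})(0) = (1/(1+4at))^{n/2}`.
[folklore] -/
private theorem heatExtension_exp_neg_mul_norm_sq_zero {a t : ℝ} (ha : 0 < a) (ht : 0 < t) :
    heatExtension (fun y : E => Real.exp (-a * ‖y‖ ^ 2)) t 0 =
      (1 / (1 + 4 * a * t)) ^ ((Module.finrank ℝ E : ℝ) / 2) := by
  rw [heatExtension_exp_neg_mul_norm_sq ha ht, norm_zero]
  simp

/-! ## (A) No uniform sup-norm gain for the heat semigroup -/

/-- **Wide Gaussians are moved arbitrarily little by `e^{tΔ}`**: for every `t > 0`,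
`e^{tΔ}(e^{-a‖·‖²})(0) = (1 + 4at)^{-n/2} → 1` as `a → 0⁺`. Since every probe has sup-norm `1`,
`sup {‖e^{tΔ}f‖_∞ / ‖f‖_∞} = 1`: the `L^∞ → L^∞` norm of `e^{tΔ}` is exactly `1`
(Grafakos Thm. 2.5.8: norm = total variation of the unit-mass kernel).
[cite: Grafakos2014, §2.5.4 Thm. 2.5.8] -/
theorem tendsto_heatExtension_gaussian_nhdsGT_zero {t : ℝ} (ht : 0 < t) :
    Tendsto (fun a : ℝ => heatExtension (fun y : E => Real.exp (-a * ‖y‖ ^ 2)) t 0)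
      (𝓝[>] 0) (𝓝 1) := by
  have hcong : (fun a : ℝ => (1 / (1 + 4 * a * t)) ^ ((Module.finrank ℝ E : ℝ) / 2)) =ᶠ[𝓝[>] 0]
      fun a : ℝ => heatExtension (fun y : E => Real.exp (-a * ‖y‖ ^ 2)) t 0 :=
    eventually_nhdsWithin_of_forall fun a (ha : 0 < a) =>
      (heatExtension_exp_neg_mul_norm_sq_zero ha ht).symm
  refine Tendsto.congr' hcong ?_
  have hbase : Tendsto (fun a : ℝ => 1 / (1 + 4 * a * t)) (𝓝[>] 0) (𝓝 1) := by
    have hc : ContinuousAt (fun a : ℝ => 1 / (1 + 4 * a * t)) 0 := by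
      refine ContinuousAt.div continuousAt_const
        ((by fun_prop : Continuous fun a : ℝ => 1 + 4 * a * t).continuousAt) ?_
      norm_num
    have h0 : (fun a : ℝ => 1 / (1 + 4 * a * t)) 0 = 1 := by norm_num
    simpa [h0] using hc.tendsto.mono_left nhdsWithin_le_nhds
  simpa using hbase.rpow_const (Or.inl one_ne_zero)

/-- **(A), Schwartz form.** For every `t > 0` and every `θ < 1` there is a Schwartz function
`f` on `E` with `0 < f ≤ 1`, `f 0 = 1`, and `θ < e^{tΔ} f (0)` (a wide Gaussian). Hence no
estimate `‖e^{tΔ} f‖_∞ ≤ θ ‖f‖_∞`, `θ < 1`, holds uniformly over Schwartz `f`: the dissipative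
linear part of a heat / Stokes / Navier–Stokes mild scheme provides NO uniform gain in the
sup-norm that could absorb a per-step increment; and, read with `e^{tΔ}` as a low-pass operator
(symbol `1` at `ξ = 0`, `heatSymbol_apply_zero`), no bound `‖L f‖_∞ ≤ ε‖f‖_∞` with `ε < 1`
holds for such an operator. [cite: Grafakos2014, §2.5.4 Thm. 2.5.8] -/
theorem exists_schwartz_heatExtension_gt {t : ℝ} (ht : 0 < t) {θ : ℝ} (hθ : θ < 1) :
    ∃ f : 𝓢(E, ℝ), (∀ x, 0 < f x ∧ f x ≤ 1) ∧ f 0 = 1 ∧ θ < heatExtension (⇑f) t 0 := by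
  have hev := (tendsto_heatExtension_gaussian_nhdsGT_zero (E := E) ht).eventually
    (lt_mem_nhds hθ)
  obtain ⟨a, ha, hgt⟩ := ((eventually_mem_nhdsWithin (a := (0 : ℝ)) (s := Ioi 0)).and hev).exists
  refine ⟨realGaussianSchwartz E a, fun x => ?_, ?_, ?_⟩
  · rw [realGaussianSchwartz_apply ha]
    exact ⟨(exp_neg_mul_norm_sq_mem_Ioc ha.le x).1, (exp_neg_mul_norm_sq_mem_Ioc ha.le x).2⟩
  · rw [realGaussianSchwartz_apply ha]
    simp
  · rwa [Literature.Analysis.FunctionSpaces.coe_realGaussianSchwartz ha]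

/-- **(A), negative form.** For `t > 0` there is NO `θ < 1` such that `|e^{tΔ} f (x)| ≤ θ` for
every Schwartz `f` with `‖f‖_∞ ≤ 1` and every `x` — the contraction constant of `e^{tΔ}` on
`L^∞` (restricted to `𝓢`) is exactly `1` (the positive direction, `‖e^{tΔ}f‖_∞ ≤ ‖f‖_∞`, is
the tree's `Literature.Analysis.UnboundedOperators.norm_heatExtension_le`).
[cite: Grafakos2014, §2.5.4 Thm. 2.5.8] -/
theorem not_exists_uniform_supNorm_contraction {t : ℝ} (ht : 0 < t) :
    ¬ ∃ θ : ℝ, θ < 1 ∧ ∀ f : 𝓢(E, ℝ), (∀ x, |f x| ≤ 1) → ∀ x, |heatExtension (⇑f) t x| ≤ θ := by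
  rintro ⟨θ, hθ, hall⟩
  obtain ⟨f, hf, -, hgt⟩ := exists_schwartz_heatExtension_gt (E := E) ht hθ
  have hb : ∀ x, |f x| ≤ 1 := fun x => by
    rw [abs_of_pos (hf x).1]
    exact (hf x).2
  have h0 := hall f hb 0
  exact lt_irrefl θ (hgt.trans_le ((le_abs_self _).trans h0))

/-! ## (B) Symbol in `[0, 1)`, sup-norm almost doubled -/

/-- The band operator applied to the two-scale probe, in closed form: for `R > 0`,
`(e^{Δ} - e^{R²Δ})(2g_R - g_{R³})(0) = 2(R/(R+1))^{n/2} - (R³/(R³+1))^{n/2} - 2(1/(1+R))^{n/2}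
+ (R/(R+1))^{n/2}` where `g_s = e^{-‖·‖²/(4s)}`. [folklore] -/
private theorem bandedHeat_probe_eq {R : ℝ} (hR : 0 < R) :
    heatExtension (fun y : E => 2 * Real.exp (-(1 / (4 * R)) * ‖y‖ ^ 2) -
        Real.exp (-(1 / (4 * R ^ 3)) * ‖y‖ ^ 2)) 1 0 -
      heatExtension (fun y : E => 2 * Real.exp (-(1 / (4 * R)) * ‖y‖ ^ 2) -
        Real.exp (-(1 / (4 * R ^ 3)) * ‖y‖ ^ 2)) (R ^ 2) 0 =
      2 * (R / (R + 1)) ^ ((Module.finrank ℝ E : ℝ) / 2) -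
        (R ^ 3 / (R ^ 3 + 1)) ^ ((Module.finrank ℝ E : ℝ) / 2) -
        2 * (1 / (1 + R)) ^ ((Module.finrank ℝ E : ℝ) / 2) +
        (R / (R + 1)) ^ ((Module.finrank ℝ E : ℝ) / 2) := by
  have hc1 : Continuous fun y : E => 2 * Real.exp (-(1 / (4 * R)) * ‖y‖ ^ 2) := by fun_prop
  have hc2 : Continuous fun y : E => Real.exp (-(1 / (4 * R ^ 3)) * ‖y‖ ^ 2) := by fun_prop
  have hb1 : ∀ y : E, ‖2 * Real.exp (-(1 / (4 * R)) * ‖y‖ ^ 2)‖ ≤ 2 := fun y => by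
    rw [Real.norm_of_nonneg (by positivity)]
    have := (exp_neg_mul_norm_sq_mem_Ioc (E := E) (a := 1 / (4 * R)) (by positivity) y).2
    linarith
  have hb2 : ∀ y : E, ‖Real.exp (-(1 / (4 * R ^ 3)) * ‖y‖ ^ 2)‖ ≤ 1 := fun y => by
    rw [Real.norm_of_nonneg (by positivity)]
    exact (exp_neg_mul_norm_sq_mem_Ioc (E := E) (a := 1 / (4 * R ^ 3)) (by positivity) y).2
  have hsmul : ∀ (t : ℝ), heatExtension (fun y : E => 2 * Real.exp (-(1 / (4 * R)) * ‖y‖ ^ 2)) t 0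
      = 2 * heatExtension (fun y : E => Real.exp (-(1 / (4 * R)) * ‖y‖ ^ 2)) t 0 := fun t => by
    have h := heatExtension_const_smul (2 : ℝ) (fun y : E => Real.exp (-(1 / (4 * R)) * ‖y‖ ^ 2)) t 0
    simpa only [smul_eq_mul] using h
  rw [heatExtension_sub_of_bound hc1 hc2 hb1 hb2 one_pos 0,
    heatExtension_sub_of_bound hc1 hc2 hb1 hb2 (by positivity : (0 : ℝ) < R ^ 2) 0, hsmul, hsmul,
    heatExtension_exp_neg_mul_norm_sq_zero (by positivity) one_pos,
    heatExtension_exp_neg_mul_norm_sq_zero (by positivity) one_pos,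
    heatExtension_exp_neg_mul_norm_sq_zero (by positivity) (by positivity),
    heatExtension_exp_neg_mul_norm_sq_zero (by positivity) (by positivity)]
  have hR0 : R ≠ 0 := hR.ne'
  have hR1 : R + 1 ≠ 0 := (by positivity : (0 : ℝ) < R + 1).ne'
  have hR1' : 1 + R ≠ 0 := (by positivity : (0 : ℝ) < 1 + R).ne'
  have hR3 : R ^ 3 + 1 ≠ 0 := (by positivity : (0 : ℝ) < R ^ 3 + 1).ne'
  have e1 : 1 / (1 + 4 * (1 / (4 * R)) * 1) = R / (R + 1) := by field_simp
  have e2 : 1 / (1 + 4 * (1 / (4 * R ^ 3)) * 1) = R ^ 3 / (R ^ 3 + 1) := by field_simp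
  have e3 : 1 / (1 + 4 * (1 / (4 * R)) * R ^ 2) = 1 / (1 + R) := by field_simp
  have e4 : 1 / (1 + 4 * (1 / (4 * R ^ 3)) * R ^ 2) = R / (R + 1) := by field_simp
  rw [e1, e2, e3, e4]
  ring

/-- **(B), limit form.** Along the two-scale probes the band operator `e^{Δ} - e^{R²Δ}` — symbol
in `[0, 1)`, zero at the origin — produces the value `→ 2` at `x = 0` from inputs of sup-norm
`≤ 1` (`0 < dim E`): `2(R/(R+1))^{n/2} - (R³/(R³+1))^{n/2} - 2(1/(1+R))^{n/2} + (R/(R+1))^{n/2}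
→ 2 - 1 - 0 + 1 = 2` as `R → ∞`. The `L^∞ → L^∞` norm of `e^{aΔ} - e^{bΔ}` is the total
variation of `heatKernel a - heatKernel b`, which tends to `2` as `b/a → ∞`.
[cite: Grafakos2014, §2.5.4 Thm. 2.5.8] -/
theorem tendsto_bandedHeat_probe_atTop [Nontrivial E] :
    Tendsto (fun R : ℝ =>
      heatExtension (fun y : E => 2 * Real.exp (-(1 / (4 * R)) * ‖y‖ ^ 2) -
          Real.exp (-(1 / (4 * R ^ 3)) * ‖y‖ ^ 2)) 1 0 -
        heatExtension (fun y : E => 2 * Real.exp (-(1 / (4 * R)) * ‖y‖ ^ 2) -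
          Real.exp (-(1 / (4 * R ^ 3)) * ‖y‖ ^ 2)) (R ^ 2) 0) atTop (𝓝 2) := by
  set c : ℝ := (Module.finrank ℝ E : ℝ) / 2 with hc_def
  have hc : 0 < c := by
    have : 0 < (Module.finrank ℝ E : ℝ) := by exact_mod_cast Module.finrank_pos
    positivity
  have hcong : (fun R : ℝ => 2 * (R / (R + 1)) ^ c - (R ^ 3 / (R ^ 3 + 1)) ^ c -
      2 * (1 / (1 + R)) ^ c + (R / (R + 1)) ^ c) =ᶠ[atTop] fun R : ℝ =>
      heatExtension (fun y : E => 2 * Real.exp (-(1 / (4 * R)) * ‖y‖ ^ 2) -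
          Real.exp (-(1 / (4 * R ^ 3)) * ‖y‖ ^ 2)) 1 0 -
        heatExtension (fun y : E => 2 * Real.exp (-(1 / (4 * R)) * ‖y‖ ^ 2) -
          Real.exp (-(1 / (4 * R ^ 3)) * ‖y‖ ^ 2)) (R ^ 2) 0 := by
    filter_upwards [eventually_gt_atTop (0 : ℝ)] with R hR
    exact (bandedHeat_probe_eq (E := E) hR).symm
  refine Tendsto.congr' hcong ?_
  -- the three elementary limits
  have hinv : Tendsto (fun R : ℝ => 1 / (1 + R)) atTop (𝓝 0) := by
    have h1 : Tendsto (fun R : ℝ => 1 + R) atTop atTop :=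
      tendsto_atTop_add_const_left atTop 1 tendsto_id
    simpa [one_div, Function.comp_def] using tendsto_inv_atTop_zero.comp h1
  have hratio : Tendsto (fun R : ℝ => R / (R + 1)) atTop (𝓝 1) := by
    have heq : (fun R : ℝ => 1 - 1 / (1 + R)) =ᶠ[atTop] fun R : ℝ => R / (R + 1) := by
      filter_upwards [eventually_gt_atTop (0 : ℝ)] with R hR
      have hR1 : R + 1 ≠ 0 := (by positivity : (0 : ℝ) < R + 1).ne'
      have hR1' : 1 + R ≠ 0 := (by positivity : (0 : ℝ) < 1 + R).ne'
      field_simp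
      ring
    refine Tendsto.congr' heq ?_
    have hc : Tendsto (fun _ : ℝ => (1 : ℝ)) atTop (𝓝 1) := tendsto_const_nhds
    simpa using hc.sub hinv
  have hratio3 : Tendsto (fun R : ℝ => R ^ 3 / (R ^ 3 + 1)) atTop (𝓝 1) := by
    have h3 : Tendsto (fun R : ℝ => R ^ 3) atTop atTop := tendsto_pow_atTop (by norm_num)
    simpa [Function.comp_def] using hratio.comp h3
  have l1 : Tendsto (fun R : ℝ => (R / (R + 1)) ^ c) atTop (𝓝 1) := by
    simpa using hratio.rpow_const (Or.inl one_ne_zero)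
  have l2 : Tendsto (fun R : ℝ => (R ^ 3 / (R ^ 3 + 1)) ^ c) atTop (𝓝 1) := by
    simpa using hratio3.rpow_const (Or.inl one_ne_zero)
  have l3 : Tendsto (fun R : ℝ => (1 / (1 + R)) ^ c) atTop (𝓝 0) :=
    hinv.rpow_const_nhds_zero hc
  have := ((l1.const_mul 2).sub l2).sub (l3.const_mul 2) |>.add l1
  simpa [show (2 : ℝ) * 1 - 1 - 2 * 0 + 1 = 2 by norm_num] using this

/-- **(B), Schwartz form: a symbol bound is not a sup-norm bound.** For every `θ < 2` there are
`0 < a < b` and a Schwartz function `f` with `‖f‖_∞ ≤ 1` such that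
`θ < (e^{aΔ} f - e^{bΔ} f)(0)`, although the symbol of `e^{aΔ} - e^{bΔ}` lies in `[0, 1)` and
vanishes at `ξ = 0` (`heatSymbol_sub_mem_Ico`, `heatSymbol_sub_apply_zero`). So the inference
«`0 ≤ m < 1` pointwise ⇒ `‖T_m f‖_∞ < ‖f‖_∞`» — valid in `L²` — FAILS in the sup-norm by a
factor approaching `2`, in every dimension `n ≥ 1`, for operators of the exact shape
«heat semigroup composed with a smooth high-pass cut-off» (`e^{aΔ}(1 - e^{(b-a)Δ})`).

BARRIER (structured block, D-0021):
technique_class: sup-norm-apriori-bound fourier-symbol-to-sup-norm frequency-cutoff-contraction heat-semigroup-strict-sup-contraction one-step-sup-norm-iteration transform-asymptotics-T4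
blocks: (1) every step of the form «the Fourier symbol `m` of `T` satisfies `|m| ≤ θ` (resp. `< 1`, resp. `≤ ε` off a small ball) pointwise, hence `‖T f‖_∞ ≤ θ ‖f‖_∞` (resp. `< ‖f‖_∞`, `≤ ε‖f‖_∞`) for all Schwartz / bounded `f`» — the `L¹ → L¹` norm of a translation-invariant operator is the total variation of its kernel, and finite measures act on every `L^p`, `1 ≤ p ≤ ∞`, with that bound (`M^{1,1} ⊂ M^{∞,∞}`) [cite: Grafakos2014, §2.5.4 Thm. 2.5.8 and the remark following its proof], so for an `L¹` kernel the `L^∞ → L^∞` norm is its `L¹` norm, not the sup of its symbol — the symbol sup is the `L² → L²` norm [cite: Grafakos2014, §2.5.4 Thm. 2.5.10]; concretely this theorem (amplification `→ 2` with symbol in `[0,1)`) and `exists_schwartz_heatExtension_gt` (no `ε`-smallness for a symbol equal to `1` at the origin); (2) every «one-step sup-norm contraction» scheme for heat / Stokes / Navier–Stokes mild formulations `u(δt) = e^{νδtΔ}u₀ + ∫₀^{δt} e^{ν(δt-s)Δ}ℙ∇·(…)`, which needs a uniform gain `‖e^{νδtΔ}u₀‖_∞ ≤ (1 - κ)‖u₀‖_∞`,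 `κ > 0` independent of `u₀`, to absorb the nonlinear increment: `κ = 0` is forced (`not_exists_uniform_supNorm_contraction`), and splitting `e^{νδtΔ}` into high- and low-frequency parts does not create a gain — the high part is not a contraction (this theorem), the low part is not small (`exists_schwartz_heatExtension_gt`); (3) the iteration of a per-step bound `|u((k+1)δt)| ≤ (1 + c)|u(kδt)|`, `c ≥ c₀ > 0` not `o(δt)`, «arbitrarily long» to a bound uniform in `k` (extremal sequence `(1 + c)^k`); dropping such increments as «small» is not a valid inference, and increments `Cδt` only give the Gronwall factor `(1 + Ct/N)^N ≤ e^{Ct}`, as good as the a priori control of `C` (for Navier–Stokes `C ∼ ‖∇u‖_∞`, the quantity at stake).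
because: `heatExtension_exp_neg_mul_norm_sq` (explicit heat flow of Gaussians) gives `e^{tΔ}g_a(0) = (1+4at)^{-n/2} → 1` (`a → 0⁺`) and, for the band `e^{Δ} - e^{R²Δ}` on `2g_{1/(4R)} - g_{1/(4R³)}`, the value `2(R/(R+1))^{n/2} - (R³/(R³+1))^{n/2} - 2(1+R)^{-n/2} + (R/(R+1))^{n/2} → 2` (`tendsto_bandedHeat_probe_atTop`): two unit-mass Gaussian bumps at separated scales with opposite signs have total variation `→ 2` while their symbol difference stays in `[0,1)` [cite: Grafakos2014, §2.5.4 Thm. 2.5.8]; all proved here over the tree's `heatExtension` / `heatKernel` / `realGaussianSchwartz` (zero fact debt).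
evasions_known: (a) `L²`- and `H^s`-based estimates, where `|m| ≤ 1` IS contraction (Plancherel [cite: Grafakos2014, §2.5.4 Thm. 2.5.10]; tree `norm_fourierMultiplier_le`) — for Navier–Stokes these are the energy class, supercritical (barrier `Literature.Barriers.NavierStokesRegularity.EnergySupercriticality`), and the classical `H^s` local theory; (b) genuine sup-norm monotonicity comes from POSITIVITY of the kernel or scalar transport structure, not from symbol size: `‖e^{tΔ}f‖_∞ ≤ ‖f‖_∞` (tree `Literature.Analysis.UnboundedOperators.norm_heatExtension_le`) [cite: Evans2010, §2.3.1], the parabolic maximum principle for scalar advection–diffusion such as the 2D vorticity `‖ω(t)‖_∞ ≤ ‖ω₀‖_∞` [cite: MajdaBertozziCUP2002, §3.3 (before Cor. 3.3)]; no such structure is available for the 3D velocity (pressure term) or the 3D vorticity (stretching term), and an `L^∞_{t,x}` velocity bound is itself a regularity criterion (tree fact `Literature.Analysis.FluidPDE.ladyzhenskaya_prodi_serrin`), i.e. the conclusion at stake rather than a lemma; (c) kernels of small total variation (genuinely small operators on `L^∞`, e.g. `e^{tΔ} - 1` on functions with `‖Δf‖_∞` controlled, gaining a factor `t‖Δf‖_∞`)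 — a DERIVATIVE cost, which is where the supercritical bookkeeping returns.
scope_caveats: (a) rendering on the kernel side: the operators are `e^{tΔ} = heatKernel t ⋆ ·` and their differences, evaluated at `x = 0` on explicit Gaussian probes; the identification with the Fourier multipliers `heatSymbol t`, `heatSymbol a - heatSymbol b` is the tree's `fourierIntegral_heatKernel_holds` [cite: SteinSingularIntegrals1970, Ch. III §2]; (b) the amplification constant `2` is approached, not attained, and is specific to zero-mean kernels made of two separated unit bumps; for a general real symbol `m` the sharp `L^∞` constant is the total variation of `m^∨`, anywhere in `[sup|m|, ∞]` [cite: Grafakos2014, §2.5.4 Thm. 2.5.8]; (c) a statement about LINEAR constant-coefficient operators on `ℝⁿ` (any `n ≥ 1`; (A) for all `n`): it refutes sup-norm steps of the displayed shapes and the bookkeeping of their iteration, and says nothing about nonlinear or solution-dependent mechanisms (e.g. a maximum principle for a cleverly chosen scalar functional of the solution), nor about Navier–Stokes regularity itself; (d) viscosity and time enter only through `νt`, so the statements are uniform in `ν > 0` after rescaling and carry over verbatim to the «`ν → 0`» riders of such schemes (the high-pass part without heat factor is the case `a → 0`).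
status: established (theorems proved in this file; classical sources cited for context)
[cite: Grafakos2014, §2.5.4 Thm. 2.5.8] -/
theorem exists_bandedHeat_supNorm_amplification [Nontrivial E] {θ : ℝ} (hθ : θ < 2) :
    ∃ a b : ℝ, 0 < a ∧ a < b ∧ ∃ f : 𝓢(E, ℝ), (∀ x, |f x| ≤ 1) ∧
      (∀ ξ : E, heatSymbol a ξ - heatSymbol b ξ ∈ Ico (0 : ℝ) 1) ∧
      θ < heatExtension (⇑f) a 0 - heatExtension (⇑f) b 0 := by
  have hev := (tendsto_bandedHeat_probe_atTop (E := E)).eventually (lt_mem_nhds hθ)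
  obtain ⟨R, hR, hgt⟩ := ((eventually_gt_atTop (1 : ℝ)).and hev).exists
  have hR0 : 0 < R := by linarith
  have ha1 : (0 : ℝ) < 1 / (4 * R) := by positivity
  have ha3 : (0 : ℝ) < 1 / (4 * R ^ 3) := by positivity
  have hfcoe : (⇑((2 : ℝ) • realGaussianSchwartz E (1 / (4 * R)) -
      realGaussianSchwartz E (1 / (4 * R ^ 3))) : E → ℝ) =
      fun y : E => 2 * Real.exp (-(1 / (4 * R)) * ‖y‖ ^ 2) -
        Real.exp (-(1 / (4 * R ^ 3)) * ‖y‖ ^ 2) := by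
    funext y
    simp only [IsSubApply.sub_apply, IsSMulApply.smul_apply, smul_eq_mul,
      realGaussianSchwartz_apply ha1, realGaussianSchwartz_apply ha3]
  refine ⟨1, R ^ 2, one_pos, by nlinarith, (2 : ℝ) • realGaussianSchwartz E (1 / (4 * R)) -
    realGaussianSchwartz E (1 / (4 * R ^ 3)), fun x => ?_, fun ξ => ?_, ?_⟩
  · rw [hfcoe]
    exact abs_twoScaleProbe_le_one hR.le x
  · exact heatSymbol_sub_mem_Ico zero_le_one (by nlinarith) ξ
  · rw [hfcoe]
    exact hgt

/-- **(B), negative form.** It is NOT true that every operator `e^{aΔ} - e^{bΔ}` (`0 < a < b`;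
symbol in `[0,1)`) satisfies `|(e^{aΔ} - e^{bΔ}) f (x)| ≤ ‖f‖_∞`-type bounds: there are
`0 < a < b`, a Schwartz `f` with `‖f‖_∞ ≤ 1` and a point where the value exceeds `1`
(`0 < dim E`). [cite: Grafakos2014, §2.5.4 Thm. 2.5.8] -/
theorem not_symbolBound_imp_supNormBound [Nontrivial E] :
    ¬ ∀ a b : ℝ, 0 < a → a < b → ∀ f : 𝓢(E, ℝ), (∀ x, |f x| ≤ 1) →
        ∀ x, |heatExtension (⇑f) a x - heatExtension (⇑f) b x| ≤ 1 := by
  intro hall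
  obtain ⟨a, b, ha, hab, f, hf, -, hgt⟩ :=
    exists_bandedHeat_supNorm_amplification (E := E) (θ := 1) (by norm_num)
  have h0 := hall a b ha hab f hf 0
  exact lt_irrefl (1 : ℝ) (hgt.trans_le ((le_abs_self _).trans h0))

end Heat


end Literature.Barriers.NavierStokesRegularity
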